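import Summits.Ventures.QEC.Thresholds.ToricCodeClusters
import Summits.Ventures.QEC.Thresholds.ToricCodeThresholds
import Summits.Ventures.QEC.Thresholds.LDPCThreshold
import Mathlib.Analysis.SpecificLimits.Normed
import HarnessLib

/-!
# Toric-code threshold by the cluster-counting route: `p₀ = 1/5184`, conditional only on `d_Z ≥ L`

Venture QEC, `Summits/Ventures/QEC/Thresholds/` (LADDER-QEC Q5). HONEST FRAMING: a SECOND, independent
route to a certified toric-code threshold under minimum-weight decoding and independent bit flips —
the Kovalev–Pryadko / Gottesman cluster-counting bound (`ClusterCountingBound.lean`, generic in the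
qubit index type) instead of Dennis et al.'s self-avoiding-polygon count. Its constant is tiny
(`p₀ = (2Δ²)⁻² = 1/5184` for the toric check graph of degree `Δ = 6`, vs. `≈ .029–.036` for the DKLP
route of `ToricCodeThresholds.lean`), but its ONLY unproved input is the toric distance statement
`ToricCode.cycle_weight_ge` ("a homologically non-trivial cycle has `≥ L` links", DKLP §5.2; named
fact of `ToricCodeThreshold.lean`, taken as the hypothesis `hL`) — it does NOT need the polygon
extraction and the walk-count lifting of the DKLP route. PROVED here (kernel axioms), on top of
`ToricCodeClusters.lean` (cut lemma, connected piece, degree `≤ 6`) and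
`ToricCodeMinWeight.lean` (half-weight inequality): the coding half `hasDenseCluster_of_not_corrects`,
the finite-size bound `failureProb_le_cluster` (`Prob_fail ≤ 2L² r^L/(36(1-r))`, `r = 72√p`, via
`sum_hasDenseCluster_le_geometric`), and the threshold `toricThreshold_clusterRoute`:
`IsThresholdLowerBound (toricFailureFamily D) (1/(4·6⁴))` for every minimum-weight decoder family.
tier: CERTIFIED-conditional (on `cycle_weight_ge` only). No Monte Carlo number here.

## References

* [DennisEtAl2002] Dennis–Kitaev–Landahl–Preskill, J. Math. Phys. 43 (2002) 4452, §5.2.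
* [Gottesman2014] D. Gottesman, Quantum Inf. Comput. 14 (2014) 1338, §4 Thm. 3 (cluster argument).
* [KovalevPryadko2013] A. A. Kovalev, L. P. Pryadko, Phys. Rev. A 87 (2013) 020304(R), Thm. 3.
-/

noncomputable section

namespace Summit.Ventures.QEC.Thresholds

open Filter Topology Finset Matrix
open Literature.InformationTheory.QuantumCodes
open Literature.InformationTheory.QuantumCodes.ToricCode
open Literature.Probability.LatticeModels

namespace ToricCluster

variable {L : ℕ}

/-! ### The coding half: failure forces a dense connected cluster -/

/-- **Failure ⟹ dense cluster** (given `d_Z ≥ L`): if a minimum-weight decoder fails on the error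
chain `e` of the `L × L` toric code, then the check graph contains a connected set `S` of `≥ L` links
at least half of which are actual errors. CONDITIONAL on `ToricCode.cycle_weight_ge`.
[cite: Gottesman2014, Thm 3 (proof, first claim)] -/
theorem hasDenseCluster_of_not_corrects [NeZero L] (hL : cycle_weight_ge) {D : ZDecoder L}
    (hD : D.IsMinWeight (syn L) (cycles L) hammingNorm) {e : Chain L}
    (hfail : ¬ D.Corrects (syn L) (boundaries L) e) :
    HasDenseCluster (checkGraph (starMatrix L)) L (supp e) := by
  set z : Chain L := e + D (syn L e) with hzdef
  have hz : z ∈ cycles L := by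
    show syn L (e + D (syn L e)) = 0
    rw [syn_add, syn_decode_eq hD e]
    funext v
    simp only [Pi.add_apply, Pi.zero_apply]
    generalize syn L e v = a
    revert a; decide
  have hzb : z ∉ boundaries L := by
    intro h
    apply hfail
    show D (syn L e) + e ∈ boundaries L
    rwa [add_comm]
  obtain ⟨A, hAsub, _, hAconn, hAz, hAb⟩ := exists_connected_piece hz hzb
  have hLA : L ≤ A.card := by
    have := hL L (Chain.restrict A z) hAz hAb
    rwa [hammingNorm_restrict_of_subset hAsub] at this
  have hhalf : A.card ≤ 2 * (A ∩ supp e).card := card_le_two_mul_card_inter_supp hD e hAsub hAz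
  exact ⟨A, hAconn, hLA, hhalf⟩

/-! ### The probabilistic half and the threshold -/

/-- The number of links of the `L × L` toric lattice is `2L²`.
[cite: DennisEtAl2002, §3.1 (2L² links)] -/
theorem card_edge (L : ℕ) [NeZero L] : Fintype.card (Edge L) = 2 * L ^ 2 := by
  rw [Fintype.card_prod, Fintype.card_fin, Fintype.card_fun, ZMod.card, Fintype.card_fin]
  ring

/-- **Finite-size bound by the cluster route** (given `d_Z ≥ L`): for a minimum-weight decoder,
`0 ≤ p ≤ 1` and `r := 72 √p < 1`, `Prob_fail ≤ 2L² · r^L / (36 (1 - r))`. CONDITIONAL on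
`ToricCode.cycle_weight_ge`. [cite: Gottesman2014, Thm 3 (n (p/p₀)^{d/2} shape)] -/
theorem failureProb_le_cluster (hL : cycle_weight_ge) (L : ℕ) [NeZero L] (hL1 : 1 ≤ L)
    {D : ZDecoder L} (hD : D.IsMinWeight (syn L) (cycles L) hammingNorm) {p : ℝ} (hp₀ : 0 ≤ p)
    (hp₁ : p ≤ 1) (hr : 2 * (6 : ℝ) ^ 2 * Real.sqrt p < 1) :
    failureProb L D p ≤ (2 * (L : ℝ) ^ 2) * (2 * (6 : ℝ) ^ 2 * Real.sqrt p) ^ L /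
      ((6 : ℝ) ^ 2 * (1 - 2 * (6 : ℝ) ^ 2 * Real.sqrt p)) := by
  classical
  rw [failureProb_eq_sum_sets]
  have hsub : (univ.filter fun E : Finset (Edge L) => ¬ D.Corrects (syn L) (boundaries L) (chainOf L E)) ⊆
      univ.filter fun E => HasDenseCluster (checkGraph (starMatrix L)) L E := by
    intro E hE
    rw [Finset.mem_filter] at hE ⊢
    have h := hasDenseCluster_of_not_corrects hL hD hE.2
    rw [supp_chainOf] at h
    exact ⟨hE.1, h⟩
  refine (Finset.sum_le_sum_of_subset_of_nonneg hsub fun E _ _ => bernoulliWeight_nonneg hp₀ hp₁ E).trans ?_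
  have hΔ : ∀ x, (checkGraph (starMatrix L)).degree x ≤ 6 := fun x => degree_starGraph_le x
  have h := sum_hasDenseCluster_le_geometric (G := checkGraph (starMatrix L)) hΔ (by norm_num)
    (isLocallyStochastic_bernoulliWeight hp₀ hp₁) hp₀ hp₁ hL1 (by exact_mod_cast hr)
  rw [card_edge] at h
  push_cast at h
  exact h

/-- **Toric-code threshold by the cluster route** (tier CERTIFIED-conditional on `d_Z ≥ L` only):
for every family of minimum-weight decoders of the `(L+1) × (L+1)` toric codes, `1/(4·6⁴) = 1/5184`
is a lower bound on the accuracy threshold under independent bit flips with perfect syndrome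
measurement. CONDITIONAL on `ToricCode.cycle_weight_ge`; otherwise unconditional (no walk-count
fact, no `native_decide`). [cite: Gottesman2014, Thm 3 (p₀ = (2ze)^{-2}, here (2Δ²)^{-2} with Δ = 6)] -/
theorem toricThreshold_clusterRoute (hL : cycle_weight_ge) {D : (L : ℕ) → ZDecoder (L + 1)}
    (hD : ∀ L, (D L).IsMinWeight (syn (L + 1)) (cycles (L + 1)) hammingNorm) :
    IsThresholdLowerBound (toricFailureFamily D) (1 / (4 * (6 : ℝ) ^ 4)) := by
  intro p hp₀ hpp
  have hp₁ : p ≤ 1 := by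
    have : 1 / (4 * (6 : ℝ) ^ 4) ≤ 1 := by norm_num
    linarith
  have hr : 2 * (6 : ℝ) ^ 2 * Real.sqrt p < 1 := by
    have := two_mul_sq_mul_sqrt_lt_one (Δ := 6) (by norm_num) (p := p) (by exact_mod_cast hpp)
    exact_mod_cast this
  set r : ℝ := 2 * (6 : ℝ) ^ 2 * Real.sqrt p with hrdef
  have hr0 : 0 ≤ r := by positivity
  -- the bound at every size
  have hbound : ∀ L, toricFailureFamily D L p ≤
      (2 * ((L : ℝ) + 1) ^ 2) * r ^ (L + 1) / ((6 : ℝ) ^ 2 * (1 - r)) := by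
    intro L
    have h := failureProb_le_cluster hL (L + 1) (by omega) (hD L) hp₀ hp₁ hr
    simp only [toricFailureFamily]
    push_cast at h
    exact h
  -- the right-hand side tends to `0`: `(L+1)² r^{L+1} → 0`
  have hlim : Tendsto (fun L : ℕ => (2 * ((L : ℝ) + 1) ^ 2) * r ^ (L + 1) / ((6 : ℝ) ^ 2 * (1 - r)))
      atTop (𝓝 0) := by
    have habs : |r| < 1 := by rw [abs_of_nonneg hr0]; exact hr
    have h1 : Tendsto (fun n : ℕ => (n : ℝ) ^ 2 * r ^ n) atTop (𝓝 0) :=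
      tendsto_pow_const_mul_const_pow_of_abs_lt_one 2 habs
    have h2 : Tendsto (fun L : ℕ => (((L + 1 : ℕ) : ℝ)) ^ 2 * r ^ (L + 1)) atTop (𝓝 0) :=
      h1.comp (tendsto_add_atTop_nat 1)
    have h3 := (h2.const_mul 2).div_const ((6 : ℝ) ^ 2 * (1 - r))
    simp only [mul_zero, zero_div] at h3
    refine h3.congr fun L => ?_
    push_cast
    ring
  have hQ : BelowThreshold (fun L (_ : ℝ) =>
      (2 * ((L : ℝ) + 1) ^ 2) * r ^ (L + 1) / ((6 : ℝ) ^ 2 * (1 - r))) p := hlim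
  exact BelowThreshold.of_le (P := toricFailureFamily D) hQ
    (fun L => by
      simp only [toricFailureFamily, failureProb]
      exact Finset.sum_nonneg fun e _ => bernoulliWeight_nonneg hp₀ hp₁ _)
    hbound

/-- Decimal form of the cluster-route value: `1/(4·6⁴) = 1/5184`. [folklore] -/
theorem one_div_four_mul_six_pow_four : 1 / (4 * (6 : ℝ) ^ 4) = 1 / 5184 := by norm_num

end ToricCluster

end Summit.Ventures.QEC.Thresholds

end
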